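import Summits.ResolutionOfSingularities.ResolutionOfSingularities.Theorems.WeightedInvariantP3aSuccessorRsp
import HarnessLib

/-!
# The P3a cylinder move: the order bound ON THE TIE CURVE from a steepened-weight witness (ORDER (o36))

Topic: `Summits/ResolutionOfSingularities/ResolutionOfSingularities/Theorems`. Helper for the door item
`HypersurfaceCentreConstruction` (statement `stmt-ResolutionOfSingularities-19897`, route `WeightedInvariant`), line
`local-engine` of `res-L1-w43-plan-1`, IOTA3-DESIGN v1.3 §8.4 regime CURVE° (RULING gen 11 #2), ORDER (o36) held by
res-type-092 (design memo `plan/tools/res-type-092/o36/O36-DESIGN.md` §4 (L3.2) «TIE ⟺ membership», §6; kernel plan v2,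
FILE C1 = «Lemma B»).

SETTING as in `…P3aSuccessorRsp`: `S` regular local, `(y, x, z)` a regular system of parameters, `P = (y, x)` prime,
`B = S[t⁻¹, 𝒥ₙ((y,x); w) tⁿ]` with charts `ρ` (`ker = (t⁻¹)`) and `ρ₀` (`ker = (t⁻¹, z)`), `W ∈ B` coordinate-like
(`ρ₀ W = Xᵢ - μXⱼ^r`), and a prime `𝔫 ∋ t⁻¹, z, W` — so `B_𝔫` is regular with regular system of parameters
`(t⁻¹, z, W[, p̃])` (`LocalGameEFTCylinder.exists_rsp_of_mem`).

* §1 `not_mem_pow_of_indexed_expansion` — K5 (`LocalGameEFTNewton.le_weight_of_mem_weightedMonomialIdeal`, all weights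
  `1`) for an expansion indexed by ANY finite set through an injective exponent map: a unit monomial of degree `< m`
  keeps `f` out of `𝔪^m`.
* §2 **`not_mem_pow_of_notMem_steepened`** («Lemma B»): let `(a₁, a₂, z)` be a regular system of parameters of `S`
  with `a₁ = (t⁻¹)^{e₁} V₁`, `a₂ = (t⁻¹)^{e₂} W` in `B` (`e₁ ≥ 1`), `V₁ ∉ 𝔫`.  If
  `f ∉ 𝒥ₘ((a₁, a₂, z); (e₁, e₂ + 1, 1))` then `f/1 ∉ 𝔪_{B_𝔫}^m`.  Proof: a unit expansion of `f` in `(a₁, a₂, z)`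
  (K5 `exists_unitExpansion`) has a witness monomial of steepened weight `< m` (`exists_weight_lt_of_not_mem`); pushed to
  `B_𝔫` it becomes the unit monomial `(c V₁^{α₁}) · (t⁻¹)^{e₁α₁+e₂α₂} z^{α₃} W^{α₂}` of total degree `< m` in the regular
  parameters, and §1 applies.
* §3 `not_mem_pow_of_factor` — bookkeeping: `f = (t⁻¹)^{rν} g` and `f/1 ∉ 𝔪^{(r+1)ν}` give `g/1 ∉ 𝔪^ν`.

In `…P3aTieFreeDrop` this is applied with `(a₁, a₂) = (x, y - λ̃x^r)`, `(e₁, e₂) = (q, r)`, `m = (r+1)ν` (the tie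
curve `Ȳ = λ̄X̄^r` of a degenerate special-fibre face) and, for `q = r = 1`, with `(a₁, a₂) = (y, x)`.  Def-free.
[OURS · L1 W4.3] Replaces the role of NO printed item; NOT a statement of the manuscript under review
[claim: Hironaka2017, status: under-review].  AI work, weaker than expert review.

## References

* H. Matsumura, *Commutative Ring Theory*, Thm. 14.2, Thm. 16.2 (quasi-regularity of a regular system of parameters).
  [Matsumura1987]
* J. Włodarczyk, *Functorial resolution by torus actions*, arXiv:2203.03090, §2.3.9, §3.3. [Wlodarczyk2022]
-/

noncomputable section

open IsLocalRing Literature.AlgebraicGeometry.Resolution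

set_option linter.dupNamespace false -- mandated namespace of this single-conjunct summit

namespace Summit.ResolutionOfSingularities.ResolutionOfSingularities.Theorems

namespace LocalGameEFTCylinder

/-! ### §1 K5 for an indexed unit expansion -/

section Indexed

variable {R : Type} [CommRing R] [IsRegularLocalRing R] {k : ℕ} (u : Fin k → R)
  (hu : Ideal.span (Set.range u) = maximalIdeal R) (hdim : ringKrullDim R = k)

include hu hdim in
/-- **A unit monomial of low degree keeps `f` out of `𝔪^m` (indexed form of K5).**  `u` a regular system of parameters
of the regular local ring `R`; `f = Σ_{s ∈ σ} a_s u^{ε s} + r` with `a_s` units, `r ∈ 𝔪^N`, `ε` injective on `σ`; if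
some `s₀ ∈ σ` has `|ε s₀| < m ≤ N` then `f ∉ 𝔪^m`. [cite: Matsumura1987, Thm. 16.2] -/
theorem not_mem_pow_of_indexed_expansion {ι : Type} (σ : Finset ι) (ε : ι → (Fin k → ℕ)) (hε : Set.InjOn ε σ)
    (a : ι → R) (ha : ∀ s ∈ σ, IsUnit (a s)) {f : R} {N : ℕ}
    (hr : f - ∑ s ∈ σ, a s * ∏ i, u i ^ ε s i ∈ maximalIdeal R ^ N) {s₀ : ι} (hs₀ : s₀ ∈ σ) {m : ℕ}
    (hm : ∑ i, ε s₀ i < m) (hmN : m ≤ N) : f ∉ maximalIdeal R ^ m := by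
  classical
  intro hf
  -- reindex by the exponents
  haveI : Nonempty ι := ⟨s₀⟩
  set ι' : (Fin k → ℕ) → ι := Function.invFunOn ε σ with hι'
  have hι'ε : ∀ s ∈ σ, ι' (ε s) = s := fun s hs =>
    hε (Function.invFunOn_mem ⟨s, hs, rfl⟩) hs (Function.invFunOn_eq ⟨s, hs, rfl⟩)
  set a' : (Fin k → ℕ) → R := fun β => a (ι' β) with ha'
  have hsum : ∑ s ∈ σ, a s * ∏ i, u i ^ ε s i = ∑ β ∈ σ.image ε, a' β * ∏ i, u i ^ β i := by
    rw [Finset.sum_image (fun s hs t ht h => hε hs ht h)]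
    refine Finset.sum_congr rfl fun s hs => ?_
    simp only [ha', hι'ε s hs]
  have hunit : ∀ β ∈ σ.image ε, IsUnit (a' β) := by
    intro β hβ
    obtain ⟨s, hs, rfl⟩ := Finset.mem_image.mp hβ
    rw [ha']
    simp only [hι'ε s hs]
    exact ha s hs
  rw [hsum] at hr
  have hone : ∀ i : Fin k, 0 < (fun _ : Fin k => 1) i := fun _ => one_pos
  have hf' : f ∈ weightedMonomialIdeal u (fun _ => 1) m := by
    rw [LocalGameEFTNewton.weightedMonomialIdeal_const_one_eq_pow u hu m]; exact hf
  have h := LocalGameEFTNewton.le_weight_of_mem_weightedMonomialIdeal u hu hdim (fun _ => 1) hone hunit hr hf' hmN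
    (ε s₀) (Finset.mem_image_of_mem ε hs₀)
  simp only [one_mul] at h
  omega

end Indexed

/-! ### §2 Lemma B: the order bound on the tie curve -/

section LemmaB

variable {S : Type} [CommRing S] [IsRegularLocalRing S] {y x z : S} {w : Fin 2 → ℕ}

/-- The exponent embedding for the parameters `(t⁻¹, z, W)` (dimension `3`): products. [folklore] -/
theorem prod_eps_three {L : Type} [CommMonoid L] (uL : Fin 3 → L) {t zL WL : L} (h0 : uL 0 = t) (h1 : uL 1 = zL)
    (h2 : uL 2 = WL) (e₁ e₂ : ℕ) (α : Fin 3 → ℕ) :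
    ∏ l, uL l ^ (![e₁ * α 0 + e₂ * α 1, α 2, α 1] : Fin 3 → ℕ) l = t ^ (e₁ * α 0 + e₂ * α 1) * zL ^ α 2 * WL ^ α 1 := by
  rw [Fin.prod_univ_three, ← h0, ← h1, ← h2]; rfl

/-- The exponent embedding for `(t⁻¹, z, W)`: degrees. [folklore] -/
theorem sum_eps_three (e₁ e₂ : ℕ) (α : Fin 3 → ℕ) :
    ∑ l, (![e₁ * α 0 + e₂ * α 1, α 2, α 1] : Fin 3 → ℕ) l = e₁ * α 0 + e₂ * α 1 + α 2 + α 1 := by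
  rw [Fin.sum_univ_three]; rfl

/-- The exponent embedding for `(t⁻¹, z, W)`: injectivity (`e₁ ≥ 1`). [folklore] -/
theorem injective_eps_three {e₁ : ℕ} (he₁ : 0 < e₁) (e₂ : ℕ) :
    Function.Injective fun α : Fin 3 → ℕ => (![e₁ * α 0 + e₂ * α 1, α 2, α 1] : Fin 3 → ℕ) := by
  intro α β h
  have h0' : e₁ * α 0 + e₂ * α 1 = e₁ * β 0 + e₂ * β 1 := congrFun h 0
  have h1' : α 2 = β 2 := congrFun h 1
  have h2' : α 1 = β 1 := congrFun h 2
  have h4 : e₂ * α 1 = e₂ * β 1 := congrArg (e₂ * ·) h2'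
  have h3 : e₁ * α 0 = e₁ * β 0 := by linarith
  have hα0 : α 0 = β 0 := Nat.eq_of_mul_eq_mul_left he₁ h3
  funext l
  fin_cases l
  · exact hα0
  · exact h2'
  · exact h1'

/-- The exponent embedding for the parameters `(t⁻¹, z, W, p̃)` (dimension `4`, last exponent `0`): products.
[folklore] -/
theorem prod_eps_four {L : Type} [CommMonoid L] (uL : Fin 4 → L) {t zL WL : L} (h0 : uL 0 = t) (h1 : uL 1 = zL)
    (h2 : uL 2 = WL) (e₁ e₂ : ℕ) (α : Fin 3 → ℕ) :
    ∏ l, uL l ^ (![e₁ * α 0 + e₂ * α 1, α 2, α 1, 0] : Fin 4 → ℕ) l =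
      t ^ (e₁ * α 0 + e₂ * α 1) * zL ^ α 2 * WL ^ α 1 := by
  rw [Fin.prod_univ_four, ← h0, ← h1, ← h2]
  change uL 0 ^ _ * uL 1 ^ _ * uL 2 ^ _ * uL 3 ^ 0 = _
  rw [pow_zero, mul_one]
  rfl

/-- The exponent embedding for `(t⁻¹, z, W, p̃)`: degrees. [folklore] -/
theorem sum_eps_four (e₁ e₂ : ℕ) (α : Fin 3 → ℕ) :
    ∑ l, (![e₁ * α 0 + e₂ * α 1, α 2, α 1, 0] : Fin 4 → ℕ) l = e₁ * α 0 + e₂ * α 1 + α 2 + α 1 := by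
  rw [Fin.sum_univ_four]
  change (e₁ * α 0 + e₂ * α 1) + α 2 + α 1 + 0 = _
  rw [add_zero]

/-- The exponent embedding for `(t⁻¹, z, W, p̃)`: injectivity (`e₁ ≥ 1`). [folklore] -/
theorem injective_eps_four {e₁ : ℕ} (he₁ : 0 < e₁) (e₂ : ℕ) :
    Function.Injective fun α : Fin 3 → ℕ => (![e₁ * α 0 + e₂ * α 1, α 2, α 1, 0] : Fin 4 → ℕ) := by
  intro α β h
  have h0' : e₁ * α 0 + e₂ * α 1 = e₁ * β 0 + e₂ * β 1 := congrFun h 0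
  have h1' : α 2 = β 2 := congrFun h 1
  have h2' : α 1 = β 1 := congrFun h 2
  have h4 : e₂ * α 1 = e₂ * β 1 := congrArg (e₂ * ·) h2'
  have h3 : e₁ * α 0 = e₁ * β 0 := by linarith
  have hα0 : α 0 = β 0 := Nat.eq_of_mul_eq_mul_left he₁ h3
  funext l
  fin_cases l
  · exact hα0
  · exact h2'
  · exact h1'

/-- **The pushed expansion** (generic in the dimension `k` of `B_𝔫`): `L` regular local with regular parameters `uL`, an
exponent embedding `ε` realising `t^{e₁α₀+e₂α₁} z^{α₂} W^{α₁}` injectively with degree `e₁α₀+e₂α₁+α₂+α₁`; then a unit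
expansion of `F` on these monomials with a witness of degree `< m` keeps `F` out of `𝔪^m`. [cite: Matsumura1987, Thm. 16.2] -/
theorem not_mem_pow_of_pushed {L : Type} [CommRing L] [IsRegularLocalRing L] {k : ℕ} (uL : Fin k → L)
    (huL : Ideal.span (Set.range uL) = maximalIdeal L) (hdim : ringKrullDim L = k) {t zL WL : L} {e₁ e₂ : ℕ}
    (ε : (Fin 3 → ℕ) → (Fin k → ℕ))
    (hε1 : ∀ α, ∏ l, uL l ^ ε α l = t ^ (e₁ * α 0 + e₂ * α 1) * zL ^ α 2 * WL ^ α 1)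
    (hε2 : Function.Injective ε) (hε3 : ∀ α, ∑ l, ε α l = e₁ * α 0 + e₂ * α 1 + α 2 + α 1)
    (Δ : Finset (Fin 3 → ℕ)) (aL : (Fin 3 → ℕ) → L) (haL : ∀ α ∈ Δ, IsUnit (aL α)) {F : L} {m : ℕ}
    (hrem : F - ∑ α ∈ Δ, aL α * (t ^ (e₁ * α 0 + e₂ * α 1) * zL ^ α 2 * WL ^ α 1) ∈ maximalIdeal L ^ m)
    {α₀ : Fin 3 → ℕ} (hα₀ : α₀ ∈ Δ) (hdeg : e₁ * α₀ 0 + e₂ * α₀ 1 + α₀ 2 + α₀ 1 < m) :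
    F ∉ maximalIdeal L ^ m := by
  simp_rw [← hε1] at hrem
  exact not_mem_pow_of_indexed_expansion uL huL hdim Δ ε (hε2.injOn) aL haL hrem hα₀ (by rw [hε3]; exact hdeg)
    le_rfl

omit [IsRegularLocalRing S] in
/-- A unit expansion of `f` in `(a₁, a₂, z)` pushed along a ring map `φ` with `φ a₁ = t^{e₁} V`, `φ a₂ = t^{e₂} W`,
`φ z = z'`: the monomials become `φ(c) V^{α₀} · t^{e₁α₀ + e₂α₁} z'^{α₂} W^{α₁}`. [folklore] -/
theorem map_expansion_eq {L : Type} [CommRing L] (φ : S →+* L) {a₁ a₂ : S} {t V W z' : L} {e₁ e₂ : ℕ}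
    (h₁ : φ a₁ = t ^ e₁ * V) (h₂ : φ a₂ = t ^ e₂ * W) (hz : φ z = z') (Δ : Finset (Fin 3 → ℕ))
    (c : (Fin 3 → ℕ) → S) :
    φ (∑ α ∈ Δ, c α * ∏ i, ![a₁, a₂, z] i ^ α i) =
      ∑ α ∈ Δ, (φ (c α) * V ^ α 0) * (t ^ (e₁ * α 0 + e₂ * α 1) * z' ^ α 2 * W ^ α 1) := by
  rw [map_sum]
  refine Finset.sum_congr rfl fun α _ => ?_
  rw [map_mul, map_prod, Fin.prod_univ_three]
  simp only [map_pow, Matrix.cons_val_zero, Matrix.cons_val_one, Matrix.cons_val, h₁, h₂, hz]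
  ring

/-- **The pushed unit expansion with a steep witness.**  `(a₁, a₂, z)` a regular system of parameters of `S`,
`φ : S → L` a ring map into a local ring with `φ a₁ = t^{e₁} V₁`, `φ a₂ = t^{e₂} W`, `t, W, φ z ∈ 𝔪_L`, `V₁` a unit,
`e₁ ≥ 1`.  If `f ∉ 𝒥ₘ((a₁, a₂, z); (e₁, e₂ + 1, 1))` then `φ f` has a unit expansion on the monomials
`t^{e₁α₀+e₂α₁} (φ z)^{α₂} W^{α₁}` modulo `𝔪_L^m` with a witness of degree `e₁α₀ + e₂α₁ + α₂ + α₁ < m`.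
[cite: Matsumura1987, Thm. 16.2] -/
theorem exists_pushed_expansion {a₁ a₂ : S} (ha : Ideal.span (Set.range ![a₁, a₂, z]) = maximalIdeal S)
    {L : Type} [CommRing L] [IsLocalRing L] (φ : S →+* L) {t V₁ W : L} {e₁ e₂ : ℕ} (he₁ : 0 < e₁)
    (hφa₁ : φ a₁ = t ^ e₁ * V₁) (hφa₂ : φ a₂ = t ^ e₂ * W) (ht : t ∈ maximalIdeal L) (hW : W ∈ maximalIdeal L)
    (hz : φ z ∈ maximalIdeal L) (hV₁ : IsUnit V₁) {f : S} {m : ℕ}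
    (hf : f ∉ weightedMonomialIdeal ![a₁, a₂, z] ![e₁, e₂ + 1, 1] m) :
    ∃ (Δ : Finset (Fin 3 → ℕ)) (aL : (Fin 3 → ℕ) → L) (α₀ : Fin 3 → ℕ), (∀ α ∈ Δ, IsUnit (aL α)) ∧
      φ f - ∑ α ∈ Δ, aL α * (t ^ (e₁ * α 0 + e₂ * α 1) * φ z ^ α 2 * W ^ α 1) ∈ maximalIdeal L ^ m ∧
      α₀ ∈ Δ ∧ e₁ * α₀ 0 + e₂ * α₀ 1 + α₀ 2 + α₀ 1 < m := by
  classical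
  have hw3 : ∀ l : Fin 3, 0 < (![e₁, e₂ + 1, 1] : Fin 3 → ℕ) l := by
    intro l; fin_cases l
    · exact he₁
    · exact Nat.succ_pos _
    · exact one_pos
  obtain ⟨Δ, c, hunit, -, hrem⟩ := LocalGameEFTNewton.exists_unitExpansion ![a₁, a₂, z] ha f m
  obtain ⟨α₀, hα₀, hlt⟩ := LocalGameEFTNewton.exists_weight_lt_of_not_mem ![a₁, a₂, z] ha ![e₁, e₂ + 1, 1] hw3 hrem
    le_rfl hf
  rw [Fin.sum_univ_three] at hlt
  simp only [Matrix.cons_val_zero, Matrix.cons_val_one, Matrix.cons_val] at hlt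
  -- `𝔪_S` maps into `𝔪_L`
  have hmS : (maximalIdeal S).map φ ≤ maximalIdeal L := by
    rw [← ha, Ideal.map_span, Ideal.span_le]
    rintro _ ⟨_, ⟨l, rfl⟩, rfl⟩
    rw [SetLike.mem_coe]
    fin_cases l
    · change φ a₁ ∈ _
      rw [hφa₁, ← Nat.sub_add_cancel he₁, pow_succ, mul_assoc]
      exact Ideal.mul_mem_left _ _ (Ideal.mul_mem_right _ _ ht)
    · change φ a₂ ∈ _
      rw [hφa₂]
      exact Ideal.mul_mem_left _ _ hW
    · exact hz
  refine ⟨Δ, fun α => φ (c α) * V₁ ^ α 0, α₀, fun α hα => ((hunit α hα).map φ).mul (hV₁.pow _), ?_, hα₀, by linarith⟩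
  have h1 : φ (f - ∑ α ∈ Δ, c α * ∏ i, ![a₁, a₂, z] i ^ α i) ∈ maximalIdeal L ^ m :=
    Ideal.pow_right_mono hmS m (by rw [← Ideal.map_pow]; exact Ideal.mem_map_of_mem φ hrem)
  have hexp := @map_expansion_eq S _ z L _ φ a₁ a₂ _ _ _ _ e₁ e₂ hφa₁ hφa₂ rfl Δ c
  rw [map_sub, hexp] at h1
  exact h1

/-- **Lemma B (the order bound on the tie curve).**  `S` regular local with regular systems of parameters `(y, x, z)`
and `(a₁, a₂, z)`, `P = (y, x)` prime, `z ∉ P`; `B = S[t⁻¹, 𝒥ₙ((y,x); w) tⁿ]` with charts `ρ` (`ker ρ = (t⁻¹)`,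
`ρ a = ā`) and `ρ₀` (`ker ρ₀ = (t⁻¹, z)`, onto `κ[X₀,X₁]`); `a₁ = (t⁻¹)^{e₁} V₁`, `a₂ = (t⁻¹)^{e₂} W` in `B` with
`e₁ ≥ 1`, `ρ₀ W = Xᵢ - μ Xⱼ^r` (`i ≠ j`).  Let `𝔫` be a prime of `B` with `t⁻¹, z, W ∈ 𝔫` and `V₁ ∉ 𝔫`.  If
`f ∉ 𝒥ₘ((a₁, a₂, z); (e₁, e₂ + 1, 1))` then `f/1 ∉ 𝔪_{B_𝔫}^m`. [cite: Matsumura1987, Thm. 16.2] -/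
theorem not_mem_pow_of_notMem_steepened [hP : (Ideal.span (Set.range ![y, x])).IsPrime]
    (hzP : z ∉ Ideal.span (Set.range ![y, x]))
    {ρ : extReesAlgebra (weightedMonomialIdeal ![y, x] w) →+*
      MvPolynomial (Fin 2) (S ⧸ Ideal.span (Set.range ![y, x]))}
    (hρker : RingHom.ker ρ = Ideal.span {extReesAlgebra.tInv (weightedMonomialIdeal ![y, x] w)})
    (hρC : ∀ a : S, ρ (algebraMap S _ a) = MvPolynomial.C (Ideal.Quotient.mk _ a))
    {κ : Type} [Field κ] {ρ₀ : extReesAlgebra (weightedMonomialIdeal ![y, x] w) →+* MvPolynomial (Fin 2) κ}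
    (hρ₀s : Function.Surjective ρ₀)
    (hρ₀ker : RingHom.ker ρ₀ = Ideal.span {extReesAlgebra.tInv (weightedMonomialIdeal ![y, x] w),
      algebraMap S _ z})
    {a₁ a₂ : S} (ha : Ideal.span (Set.range ![a₁, a₂, z]) = maximalIdeal S) {e₁ e₂ : ℕ} (he₁ : 0 < e₁)
    {V₁ W : extReesAlgebra (weightedMonomialIdeal ![y, x] w)}
    (hV₁ : algebraMap S _ a₁ = extReesAlgebra.tInv (weightedMonomialIdeal ![y, x] w) ^ e₁ * V₁)
    (hW₂ : algebraMap S _ a₂ = extReesAlgebra.tInv (weightedMonomialIdeal ![y, x] w) ^ e₂ * W)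
    {i j : Fin 2} (hij : i ≠ j) {μ : κ} {r : ℕ}
    (hW : ρ₀ W = MvPolynomial.X i - MvPolynomial.C μ * MvPolynomial.X j ^ r)
    (𝔫 : Ideal (extReesAlgebra (weightedMonomialIdeal ![y, x] w))) [𝔫.IsPrime]
    (hT : extReesAlgebra.tInv (weightedMonomialIdeal ![y, x] w) ∈ 𝔫) (hz : algebraMap S _ z ∈ 𝔫) (hW𝔫 : W ∈ 𝔫)
    (hV₁𝔫 : V₁ ∉ 𝔫) {f : S} {m : ℕ} (hf : f ∉ weightedMonomialIdeal ![a₁, a₂, z] ![e₁, e₂ + 1, 1] m) :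
    algebraMap _ (Localization.AtPrime 𝔫) (algebraMap S (extReesAlgebra (weightedMonomialIdeal ![y, x] w)) f) ∉
      maximalIdeal (Localization.AtPrime 𝔫) ^ m := by
  classical
  -- the regular system of parameters of `B_𝔫`
  obtain ⟨k, v, h0, h1, h2, hk4, hv0, hv1, hv2, -, hreg, hdimk, hvmax⟩ :=
    exists_rsp_of_mem (w := w) hzP hρker hρC hρ₀s hρ₀ker hij hW 𝔫 hT hz hW𝔫
  haveI := hreg
  -- the pushed expansion
  obtain ⟨φ, hφ⟩ : ∃ φ : S →+* Localization.AtPrime 𝔫, φ =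
      (algebraMap _ (Localization.AtPrime 𝔫)).comp (algebraMap S (extReesAlgebra (weightedMonomialIdeal ![y, x] w))) :=
    ⟨_, rfl⟩
  have hφa₁ : φ a₁ = algebraMap _ (Localization.AtPrime 𝔫) (extReesAlgebra.tInv (weightedMonomialIdeal ![y, x] w)) ^ e₁ *
      algebraMap _ (Localization.AtPrime 𝔫) V₁ := by
    rw [hφ, RingHom.comp_apply, hV₁, map_mul, map_pow]
  have hφa₂ : φ a₂ = algebraMap _ (Localization.AtPrime 𝔫) (extReesAlgebra.tInv (weightedMonomialIdeal ![y, x] w)) ^ e₂ *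
      algebraMap _ (Localization.AtPrime 𝔫) W := by
    rw [hφ, RingHom.comp_apply, hW₂, map_mul, map_pow]
  have hφz : φ z = algebraMap _ (Localization.AtPrime 𝔫)
      (algebraMap S (extReesAlgebra (weightedMonomialIdeal ![y, x] w)) z) := by
    rw [hφ, RingHom.comp_apply]
  have hmaxmem : ∀ b ∈ 𝔫, algebraMap _ (Localization.AtPrime 𝔫) b ∈ maximalIdeal (Localization.AtPrime 𝔫) :=
    fun b hb => by rw [← Localization.AtPrime.map_eq_maximalIdeal]; exact Ideal.mem_map_of_mem _ hb
  have hφzmem : φ z ∈ maximalIdeal (Localization.AtPrime 𝔫) := by rw [hφz]; exact hmaxmem _ hz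
  have hV₁u : IsUnit (algebraMap _ (Localization.AtPrime 𝔫) V₁) :=
    IsLocalization.map_units (M := 𝔫.primeCompl) _ ⟨V₁, hV₁𝔫⟩
  obtain ⟨Δ, aL, α₀, hunitL, hremL, hα₀, hdeg⟩ :=
    exists_pushed_expansion (L := Localization.AtPrime 𝔫) ha φ he₁ hφa₁ hφa₂ (hmaxmem _ hT) (hmaxmem _ hW𝔫) hφzmem
      hV₁u hf
  rw [hφz] at hremL
  have hgoal : algebraMap _ (Localization.AtPrime 𝔫) (algebraMap S (extReesAlgebra (weightedMonomialIdeal ![y, x] w)) f) =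
      φ f := by rw [hφ, RingHom.comp_apply]
  rw [hgoal]
  -- two arities for the regular system of parameters
  have hk : k = 3 ∨ k = 4 := by omega
  rcases hk with rfl | rfl
  · -- generic point of the tie curve: parameters `(t⁻¹, z, W)`
    have hv0' : v 0 = extReesAlgebra.tInv (weightedMonomialIdeal ![y, x] w) := hv0
    have hv1' : v 1 = algebraMap S _ z := hv1
    have hv2' : v 2 = W := hv2
    exact not_mem_pow_of_pushed (fun l => algebraMap _ (Localization.AtPrime 𝔫) (v l)) hvmax hdimk
      (fun α => (![e₁ * α 0 + e₂ * α 1, α 2, α 1] : Fin 3 → ℕ))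
      (prod_eps_three _ (by simp only [hv0']) (by simp only [hv1']) (by simp only [hv2']) e₁ e₂)
      (injective_eps_three he₁ e₂) (sum_eps_three e₁ e₂) Δ aL hunitL hremL hα₀ hdeg
  · -- closed point: parameters `(t⁻¹, z, W, p̃)`
    have hv0' : v 0 = extReesAlgebra.tInv (weightedMonomialIdeal ![y, x] w) := hv0
    have hv1' : v 1 = algebraMap S _ z := hv1
    have hv2' : v 2 = W := hv2
    exact not_mem_pow_of_pushed (fun l => algebraMap _ (Localization.AtPrime 𝔫) (v l)) hvmax hdimk
      (fun α => (![e₁ * α 0 + e₂ * α 1, α 2, α 1, 0] : Fin 4 → ℕ))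
      (prod_eps_four _ (by simp only [hv0']) (by simp only [hv1']) (by simp only [hv2']) e₁ e₂)
      (injective_eps_four he₁ e₂) (sum_eps_four e₁ e₂) Δ aL hunitL hremL hα₀ hdeg

end LemmaB

/-! ### §3 From `f` to its saturated factor -/

/-- **From `f/1 ∉ 𝔪^{a + ν}` to `g/1 ∉ 𝔪^ν` when `f = t^a g` with `t ∈ 𝔪`** (stated over `CommSemiring` so that it
applies to `Localization.AtPrime` along its own instance path). [folklore] -/
theorem not_mem_pow_of_factor {L : Type} [CommSemiring L] [IsLocalRing L] {t g : L} (ht : t ∈ maximalIdeal L)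
    {a ν : ℕ}
    (hf : t ^ a * g ∉ maximalIdeal L ^ (a + ν)) : g ∉ maximalIdeal L ^ ν := fun hg =>
  hf (by rw [pow_add]; exact Ideal.mul_mem_mul (Ideal.pow_mem_pow ht a) hg)

end LocalGameEFTCylinder

end Summit.ResolutionOfSingularities.ResolutionOfSingularities.Theorems

end
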